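import Summits.Parity.BatemanHorn.Theorems.AlmostPrimeZerosSystemLSDRealSegmentRealForm
import HarnessLib

/-!
# The finite Euler product of the real local factors: `∏_{p ≤ N} E_p(y) ∼ λ_f(y) e^{γ k(y−1)} (log N)^{k(y−1)}`

Crux `SystemLSDRealSegment` (stmt-Parity-11292, route `AlmostPrimeZeros`), line `beta-thinned-root-kernel`, support
programme of the lead c9 (localisation of the kernel to rough divisor tuples).  For a Bateman–Horn system `f` of `k`
members and a real `y ≥ 1`, the Type-I coefficient `b = bCoeff f y` has the real local factor
`E_p(y) = Σ_{ν ≤ 2k} b(p^ν)` at each prime `p` (`b(p^ν) = 0` for `ν > 2k`).  This file proves the registered stub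
`eulerProduct_primesLE_asymp` of the skeleton:
`∏_{p ≤ N} E_p(y) / (log N)^{k(y−1)} → Re λ_f(y) · e^{γ k(y−1)}` as `N → ∞`.

Proof.  By `exists_eulerFactor_ofReal` (file `…RealForm`), `∏_{p ≤ N} (Σ_ν b(p^ν)) (1 − 1/p)^κ → P` with
`λ_f(y) = P` real and `κ = k(y−1) ≥ 0`; the series `Σ_ν b(p^ν)` is the finite sum `E_p(y)`
(`bCoeff_prime_pow_eq_zero`).  Mertens' third theorem (`log N · ∏_{p ≤ N} (1 − 1/p) → e^{−γ}`,
`Literature.NumberTheory.LFunctions.Mertens.tendsto_log_mul_prod_one_sub_inv_nat`) raised to the power `−κ` gives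
`(log N · ∏_{p ≤ N} (1 − 1/p))^{−κ} → e^{γκ}`, and for `N ≥ 2` the product of the two sequences is exactly
`∏_{p ≤ N} E_p(y) / (log N)^κ`.  Everything here is PROVED; no definitions.
-/

open Filter Finset Polynomial
open scoped BigOperators Topology

namespace Summit.Parity.BatemanHorn.Cruxes.SystemLSDRealSegment.BetaThinnedRootKernel

open Literature.NumberTheory.Sieve

noncomputable section

/-- Mertens' third theorem raised to a real power `−κ`: `(log N · ∏_{p ≤ N} (1 − 1/p))^{−κ} → e^{γκ}`
(the limit `e^{−γ}` is positive, so `Tendsto.rpow_const` applies for every real exponent). [folklore] -/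
theorem tendsto_log_mul_prod_one_sub_rpow_neg (κ : ℝ) :
    Tendsto (fun N : ℕ => (Real.log N * ∏ p ∈ Nat.primesLE N, (1 - 1 / (p : ℝ))) ^ (-κ)) atTop
      (𝓝 (Real.exp (Real.eulerMascheroniConstant * κ))) := by
  have h := (Literature.NumberTheory.LFunctions.Mertens.tendsto_log_mul_prod_one_sub_inv_nat).rpow_const
    (p := -κ) (Or.inl (Real.exp_pos _).ne')
  rw [← Real.exp_mul, neg_mul_neg] at h
  refine h.congr fun N => ?_
  simp_rw [one_div]

/-- For `N ≥ 2` and nonnegative reals `E p`, the algebraic identity behind the stub: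
`(∏_{p ≤ N} E_p (1 − 1/p)^κ) · (log N · ∏_{p ≤ N} (1 − 1/p))^{−κ} = ∏_{p ≤ N} E_p / (log N)^κ`
(all of `1 − 1/p` (`p` prime) and `log N` are positive). [folklore] -/
theorem prod_mul_rpow_mul_rpow_neg_eq (E : ℕ → ℝ) (κ : ℝ) {N : ℕ} (hN : 2 ≤ N) :
    (∏ p ∈ Nat.primesLE N, E p * (1 - 1 / (p : ℝ)) ^ κ) *
        (Real.log N * ∏ p ∈ Nat.primesLE N, (1 - 1 / (p : ℝ))) ^ (-κ) =
      (∏ p ∈ Nat.primesLE N, E p) / Real.log N ^ κ := by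
  have hfac : ∀ p ∈ Nat.primesLE N, 0 < 1 - 1 / (p : ℝ) := by
    intro p hp
    have hp2 : (2 : ℝ) ≤ p := by exact_mod_cast (Nat.prime_of_mem_primesLE hp).two_le
    exact sub_pos.2 ((div_lt_one (by linarith)).2 (by linarith))
  have hQ : 0 < ∏ p ∈ Nat.primesLE N, (1 - 1 / (p : ℝ)) := Finset.prod_pos hfac
  have hN' : (2 : ℝ) ≤ N := by exact_mod_cast hN
  have hL : 0 < Real.log N := Real.log_pos (by linarith)
  have hQκ : 0 < (∏ p ∈ Nat.primesLE N, (1 - 1 / (p : ℝ))) ^ κ := Real.rpow_pos_of_pos hQ κ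
  have hLκ : 0 < Real.log N ^ κ := Real.rpow_pos_of_pos hL κ
  rw [Finset.prod_mul_distrib, Real.finsetProd_rpow _ _ (fun p hp => (hfac p hp).le),
    Real.rpow_neg (mul_pos hL hQ).le, Real.mul_rpow hL.le hQ.le]
  field_simp

/-- **eulerProduct_primesLE_asymp** (registered stub of the skeleton, line `beta-thinned-root-kernel`):
for every Bateman–Horn system `f` of `k` members and every real `y ≥ 1`,
`∏_{p ≤ N} (Σ_{ν ≤ 2k} b(p^ν)) / (log N)^{k(y−1)} → Re λ_f(y) · e^{γ k(y−1)}` as `N → ∞`, `b = bCoeff f y`,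
`λ_f(y) = eulerFactor f y` (the Levin–Faĭnleĭb product `exists_eulerFactor_ofReal` divided by Mertens'
`(log N ∏_{p ≤ N}(1 − 1/p))^{k(y−1)} → e^{−γ k(y−1)}`). [folklore] -/
theorem eulerProduct_primesLE_asymp :
    ∀ (k : ℕ) (f : Fin k → ℤ[X]), IsBatemanHornSystem f → ∀ y : ℝ, 1 ≤ y →
      Tendsto (fun N : ℕ => (∏ p ∈ Nat.primesLE N, ∑ ν ∈ range (2 * k + 1), bCoeff f y (p ^ ν)) /
          Real.log N ^ ((k : ℝ) * (y - 1))) atTop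
        (𝓝 ((eulerFactor f (y : ℂ)).re * Real.exp (Real.eulerMascheroniConstant * ((k : ℝ) * (y - 1))))) := by
  intro k f hf y hy
  obtain ⟨P, hP, hprod, -⟩ := exists_eulerFactor_ofReal hf hy
  have hPre : (eulerFactor f (y : ℂ)).re = P := by rw [hP, Complex.ofReal_re]
  -- the series of the `b(p^ν)` is the finite sum over `ν ≤ 2k`
  have htsum : ∀ p : ℕ, p.Prime →
      ∑' ν : ℕ, bCoeff f y (p ^ ν) = ∑ ν ∈ range (2 * k + 1), bCoeff f y (p ^ ν) := by
    intro p hp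
    refine tsum_eq_sum fun ν hν => bCoeff_prime_pow_eq_zero f y hp ?_
    rw [Finset.mem_range, not_lt] at hν
    omega
  have hprod' : Tendsto (fun N : ℕ => ∏ p ∈ Nat.primesLE N,
      (∑ ν ∈ range (2 * k + 1), bCoeff f y (p ^ ν)) * (1 - 1 / (p : ℝ)) ^ ((k : ℝ) * (y - 1)))
      atTop (𝓝 P) := by
    refine hprod.congr fun N => ?_
    exact Finset.prod_congr rfl fun p hp => by rw [htsum p (Nat.prime_of_mem_primesLE hp)]
  rw [hPre]
  refine (hprod'.mul (tendsto_log_mul_prod_one_sub_rpow_neg ((k : ℝ) * (y - 1)))).congr' ?_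
  filter_upwards [eventually_ge_atTop 2] with N hN
  exact prod_mul_rpow_mul_rpow_neg_eq _ _ hN

end

end Summit.Parity.BatemanHorn.Cruxes.SystemLSDRealSegment.BetaThinnedRootKernel
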